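import Summits.QuantumFields.YangMills.Theorems.ColdStartUniversalityLatticeLangevinLawAbsCont
import Summits.QuantumFields.YangMills.Theorems.ColdStartUniversalityLatticeLangevinWilsonInvariant
import Literature.MathematicalPhysics.QuantumFieldTheory.LatticeGaugeProofs
import HarnessLib

/-!
# Route `ColdStartUniversality`, crux K_A2 `ColdStartContinuumCauchy` (stmt-QuantumFields-24810), LINE 3 «lindeberg_swap»:
# A UNIFORM-IN-TIME DENSITY BOUND FOR THE LAW OF THE SZZ DYNAMICS AFTER A POSITIVE TIME

Helper file (seat `ym-line-csu-p1`, g9; `--supports stmt-QuantumFields-24810`).  Brick (ii) of the proof plan for the registered rung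
`stub_shortWindowSwap` (memo v3 on the crux).  For the SU(2) lattice Langevin (SZZ) dynamics at ANY coupling `β'`, every start `z` and
every lattice time `t₁ > 0`, there is `C = C(L, β', z, t₁)` such that EVERY solution `U` from `z` on ANY probability space satisfies

  `law(U_t) ≤ C · Haar^{⊗E}`  for ALL `t ≥ t₁`        (`map_le_smul_haar_of_le`).

Ingredients: (1) at the single time `t₁` the law is dominated by a multiple of product Haar (`map_le_smul_haar`; the argument of
`map_absolutelyContinuous_haar` (g8): ground-state comparison with the `β' = 0` dynamics `integral_le_exp_mul_integral_beta_zero` +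
heat-kernel domination `map_le_smul_haar_beta_zero`, kept quantitative); (2) product Haar and the Wilson–Gibbs measure dominate each
other up to constants (bounded action on a finite torus, `wilsonMeasure_le_smul_pi_haar`, `pi_haar_le_smul_wilsonMeasure`); (3) THE
transition kernels leave the Wilson measure invariant (SZZ Lemma 3.3 as a theorem, `wilsonMeasureLangevinInvariant_su2`, in kernel form
`wilsonMeasureLangevinInvariant_iff_kernelInvariant`) and satisfy Chapman–Kolmogorov (`chapmanKolmogorov_szz`), so
`law(U_{t₁+s}) = law(U_{t₁}) κ_s ≤ C₁ Haar κ_s ≤ C₁ a μ_W κ_s = C₁ a μ_W ≤ C₁ a² Haar`.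
THEOREMS ONLY, no sorry.  HONEST FRAMING: plumbing for the rung's dominated-convergence step; no crux, rung or summit is proved; the
Yang–Mills mass gap is NOT proved.
-/

set_option autoImplicit false

noncomputable section

namespace Summit.QuantumFields.YangMills.Theorems.ColdStartUniversality

open MeasureTheory ProbabilityTheory
open scoped NNReal ENNReal
open Literature.Probability.Process Literature.MathematicalPhysics.QuantumFieldTheory
open Literature.MathematicalPhysics.QuantumLattice (fundamentalRep fundamentalLatticeRep continuous_fundamentalRep)

variable {L : ℕ} [NeZero L]

/-! ## §1 Product Haar and the Wilson measure dominate each other -/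

/-- **Two-sided comparison of the Wilson–Gibbs measure with product Haar** on a finite torus (bounded action): there is `a > 0`
with `μ_W ≤ a · Haar^{⊗E}` and `Haar^{⊗E} ≤ a · μ_W`. [folklore] -/
theorem wilsonMeasure_le_smul_pi_haar_and (β : ℝ) :
    ∃ a : ℝ, 0 < a ∧
      wilsonMeasure (d := 3) (L := L) (fundamentalRep (Fin 2)) β ≤
        (ENNReal.ofReal a) • (Measure.pi fun _ : Edge 3 L => haarProbability (Matrix.specialUnitaryGroup (Fin 2) ℂ)) ∧
      (Measure.pi fun _ : Edge 3 L => haarProbability (Matrix.specialUnitaryGroup (Fin 2) ℂ)) ≤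
        (ENNReal.ofReal a) • wilsonMeasure (d := 3) (L := L) (fundamentalRep (Fin 2)) β := by
  haveI : IsProbabilityMeasure (haarProbability (Matrix.specialUnitaryGroup (Fin 2) ℂ)) := inferInstance
  set π : Measure (GaugeConfig 3 L (Matrix.specialUnitaryGroup (Fin 2) ℂ)) :=
    Measure.pi fun _ : Edge 3 L => haarProbability (Matrix.specialUnitaryGroup (Fin 2) ℂ) with hπ
  haveI : IsProbabilityMeasure π := by rw [hπ]; infer_instance
  obtain ⟨B, hB⟩ := exists_abs_wilsonAction_le (d := 3) (L := L) (fundamentalRep (Fin 2)) (continuous_fundamentalRep (Fin 2))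
  set w : GaugeConfig 3 L (Matrix.specialUnitaryGroup (Fin 2) ℂ) → ℝ≥0∞ :=
    fun U => ENNReal.ofReal (Real.exp (-β * wilsonAction (fundamentalRep (Fin 2)) U)) with hw
  set ep : ℝ := Real.exp (|β| * B) with hep
  set em : ℝ := Real.exp (-(|β| * B)) with hem
  have heppos : 0 < ep := Real.exp_pos _
  have hempos : 0 < em := Real.exp_pos _
  have hbound : ∀ U : GaugeConfig 3 L (Matrix.specialUnitaryGroup (Fin 2) ℂ), |β * wilsonAction (fundamentalRep (Fin 2)) U| ≤ |β| * B :=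
    fun U => by rw [abs_mul]; exact mul_le_mul_of_nonneg_left (hB U) (abs_nonneg _)
  have hw_le : ∀ U, w U ≤ ENNReal.ofReal ep := fun U => ENNReal.ofReal_le_ofReal (Real.exp_le_exp.2 (by
    have := (abs_le.1 (hbound U)).1; linarith))
  have hw_ge : ∀ U, ENNReal.ofReal em ≤ w U := fun U => ENNReal.ofReal_le_ofReal (Real.exp_le_exp.2 (by
    have := (abs_le.1 (hbound U)).2; linarith))
  -- the weight measure and the partition function
  have hW : wilsonWeight (d := 3) (L := L) (fundamentalRep (Fin 2)) β = π.withDensity w := rfl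
  set Z : ℝ≥0∞ := partitionFunction (d := 3) (L := L) (fundamentalRep (Fin 2)) β with hZdef
  have hZ : Z = ∫⁻ U, w U ∂π := by
    rw [hZdef, partitionFunction, hW, withDensity_apply _ MeasurableSet.univ, Measure.restrict_univ]
  have hZlow : ENNReal.ofReal em ≤ Z := by
    rw [hZ]
    calc ENNReal.ofReal em = ∫⁻ _U, ENNReal.ofReal em ∂π := by rw [lintegral_const, measure_univ, mul_one]
      _ ≤ _ := lintegral_mono fun U => hw_ge U
  have hZup : Z ≤ ENNReal.ofReal ep := by
    rw [hZ]
    calc _ ≤ ∫⁻ _U, ENNReal.ofReal ep ∂π := lintegral_mono fun U => hw_le U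
      _ = _ := by rw [lintegral_const, measure_univ, mul_one]
  have hZ0 : Z ≠ 0 := (lt_of_lt_of_le (ENNReal.ofReal_pos.2 hempos) hZlow).ne'
  have hZtop : Z ≠ ∞ := ne_top_of_le_ne_top ENNReal.ofReal_ne_top hZup
  have hμW : wilsonMeasure (d := 3) (L := L) (fundamentalRep (Fin 2)) β = Z⁻¹ • π.withDensity w := by
    rw [wilsonMeasure, hZdef, hW]
  -- the comparison constants in `ℝ≥0∞`
  have hinv_em : (ENNReal.ofReal em)⁻¹ = ENNReal.ofReal ep := by
    rw [← ENNReal.ofReal_inv_of_pos hempos, hem, hep, Real.exp_neg, inv_inv]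
  have hZinv_le : Z⁻¹ ≤ ENNReal.ofReal ep := by
    rw [← hinv_em]; exact ENNReal.inv_le_inv.2 hZlow
  refine ⟨ep * ep, mul_pos heppos heppos, ?_, ?_⟩
  · -- `μ_W = Z⁻¹ • π.withDensity w ≤ Z⁻¹ ep • π ≤ ep² • π`
    rw [hμW, Measure.le_iff]
    intro s hs
    rw [Measure.smul_apply, Measure.smul_apply, smul_eq_mul, smul_eq_mul, withDensity_apply _ hs,
      ENNReal.ofReal_mul heppos.le]
    calc Z⁻¹ * ∫⁻ U in s, w U ∂π ≤ Z⁻¹ * ∫⁻ _U in s, ENNReal.ofReal ep ∂π :=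
          mul_le_mul' le_rfl (lintegral_mono fun U => hw_le U)
      _ = Z⁻¹ * (ENNReal.ofReal ep * π s) := by rw [lintegral_const, Measure.restrict_apply_univ]
      _ ≤ ENNReal.ofReal ep * (ENNReal.ofReal ep * π s) := mul_le_mul' hZinv_le le_rfl
      _ = ENNReal.ofReal ep * ENNReal.ofReal ep * π s := (mul_assoc _ _ _).symm
  · -- `π ≤ ep • π.withDensity w = ep Z • μ_W ≤ ep² • μ_W`
    rw [hμW, Measure.le_iff]
    intro s hs
    rw [Measure.smul_apply, Measure.smul_apply, smul_eq_mul, smul_eq_mul, withDensity_apply _ hs,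
      ENNReal.ofReal_mul heppos.le]
    have h1 : π s ≤ ENNReal.ofReal ep * ∫⁻ U in s, w U ∂π := by
      calc π s = ∫⁻ _U in s, (1 : ℝ≥0∞) ∂π := by rw [lintegral_const, Measure.restrict_apply_univ, one_mul]
        _ ≤ ∫⁻ U in s, ENNReal.ofReal ep * w U ∂π := by
            refine lintegral_mono fun U => ?_
            calc (1 : ℝ≥0∞) = ENNReal.ofReal ep * ENNReal.ofReal em := by
                  rw [← ENNReal.ofReal_mul heppos.le, hep, hem, ← Real.exp_add, add_neg_cancel, Real.exp_zero,
                    ENNReal.ofReal_one]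
              _ ≤ ENNReal.ofReal ep * w U := mul_le_mul' le_rfl (hw_ge U)
        _ = ENNReal.ofReal ep * ∫⁻ U in s, w U ∂π := by
            rw [lintegral_const_mul' _ _ ENNReal.ofReal_ne_top]
    have h2 : ∫⁻ U in s, w U ∂π = Z * (Z⁻¹ * ∫⁻ U in s, w U ∂π) := by
      rw [← mul_assoc, ENNReal.mul_inv_cancel hZ0 hZtop, one_mul]
    calc π s ≤ ENNReal.ofReal ep * ∫⁻ U in s, w U ∂π := h1
      _ = ENNReal.ofReal ep * (Z * (Z⁻¹ * ∫⁻ U in s, w U ∂π)) := by rw [← h2]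
      _ ≤ ENNReal.ofReal ep * (ENNReal.ofReal ep * (Z⁻¹ * ∫⁻ U in s, w U ∂π)) :=
          mul_le_mul' le_rfl (mul_le_mul' hZup le_rfl)
      _ = ENNReal.ofReal ep * ENNReal.ofReal ep * (Z⁻¹ * ∫⁻ U in s, w U ∂π) := (mul_assoc _ _ _).symm

/-! ## §2 The law at one positive time is dominated by product Haar -/

/-- **The law of the SZZ dynamics at a positive time is dominated by a multiple of product Haar** (every coupling, every solution
from a deterministic start on any space; the argument of `map_absolutelyContinuous_haar` kept quantitative). [folklore] -/
theorem map_le_smul_haar (β' : ℝ) {t : ℝ≥0} (ht : 0 < (t : ℝ))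
    (z : GaugeConfig 3 L (Matrix.specialUnitaryGroup (Fin 2) ℂ))
    {Ω : Type} [MeasurableSpace Ω] {P : Measure Ω} [IsProbabilityMeasure P]
    {W : ℝ≥0 → Ω → (Edge 3 L × NoiseIdx 2 → ℝ)} (hW : IsFlatBrownian W P)
    {U : ℝ≥0 → Ω → GaugeConfig 3 L (Matrix.specialUnitaryGroup (Fin 2) ℂ)} (hU0 : ∀ ω, U 0 ω = z)
    (hU : (latticeLangevinDynamics (fundamentalLatticeRep 2) β').IsSolution (fundamentalRep (Fin 2)) hW.natFiltration P W U) :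
    ∃ C : ℝ, 0 ≤ C ∧ P.map (U t) ≤ (ENNReal.ofReal C) •
      (Measure.pi fun _ : Edge 3 L => haarProbability (Matrix.specialUnitaryGroup (Fin 2) ℂ)) := by
  classical
  haveI := secondCountableTopology_su2
  haveI := borelSpace_config L
  haveI : IsProbabilityMeasure (haarProbability (Matrix.specialUnitaryGroup (Fin 2) ℂ)) := inferInstance
  haveI := isProbabilityMeasure_piWiener (Edge 3 L × NoiseIdx 2)
  have hWc := isFlatBrownian_piWiener 3 L (NoiseIdx 2)
  obtain ⟨X, GX, hX, hXm, -, -, -⟩ := exists_regularFlow L β' hWc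
  obtain ⟨Y, GY, hY, hYm, -, -, -⟩ := exists_regularFlow L 0 hWc
  have hlaw : P.map (U t) = (Measure.pi fun _ : Edge 3 L × NoiseIdx 2 => preWienerMeasure).map (X z t) :=
    lawUnique_of_start β' z hW hWc hU0 hU (fun ω => (hX z).1 ω) (hX z).2 t
  rw [hlaw]
  have hmX : Measurable (X z t) := ((hX z).2.adapted t).mono (hWc.natFiltration.le t) le_rfl
  have hmY : Measurable (Y z t) := ((hY z).2.adapted t).mono (hWc.natFiltration.le t) le_rfl
  set lawX := (Measure.pi fun _ : Edge 3 L × NoiseIdx 2 => preWienerMeasure).map (X z t) with hlawX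
  set lawY := (Measure.pi fun _ : Edge 3 L × NoiseIdx 2 => preWienerMeasure).map (Y z t) with hlawY
  haveI : IsProbabilityMeasure lawX := Measure.isProbabilityMeasure_map hmX.aemeasurable
  haveI : IsProbabilityMeasure lawY := Measure.isProbabilityMeasure_map hmY.aemeasurable
  obtain ⟨K, Mψ, hcmp⟩ := integral_le_exp_mul_integral_beta_zero (L := L) β' hWc X hX hXm hWc Y hY hYm
  set c : ℝ := Real.exp (K * t + Mψ) with hc
  haveI : IsFiniteMeasure ((ENNReal.ofReal c) • lawY) :=
    ⟨by rw [Measure.smul_apply, smul_eq_mul]; exact ENNReal.mul_lt_top ENNReal.ofReal_lt_top (measure_lt_top _ _)⟩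
  have hle : lawX ≤ (ENNReal.ofReal c) • lawY := by
    refine measure_le_of_forall_integral_le fun f hf hf0 hf1 => ?_
    rw [integral_smul_measure, ENNReal.toReal_ofReal (Real.exp_pos _).le, smul_eq_mul, hlawX, hlawY,
      integral_map hmX.aemeasurable hf.aestronglyMeasurable, integral_map hmY.aemeasurable hf.aestronglyMeasurable]
    exact hcmp f hf hf0 hf1 z t
  obtain ⟨C, hC0, hYle⟩ := map_le_smul_haar_beta_zero (L := L) ht z hWc (fun ω => (hY z).1 ω) (hY z).2
  refine ⟨c * C, mul_nonneg (Real.exp_pos _).le hC0, ?_⟩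
  rw [ENNReal.ofReal_mul (Real.exp_pos _).le]
  refine hle.trans (Measure.le_iff'.2 fun A => ?_)
  have h1 := Measure.le_iff'.1 hYle A
  simp only [Measure.smul_apply, smul_eq_mul] at h1 ⊢
  calc ENNReal.ofReal c * lawY A ≤ ENNReal.ofReal c * (ENNReal.ofReal C *
      (Measure.pi fun _ : Edge 3 L => haarProbability (Matrix.specialUnitaryGroup (Fin 2) ℂ)) A) := mul_le_mul' le_rfl h1
    _ = _ := (mul_assoc _ _ _).symm

/-! ## §3 Uniformity in time, through the invariant Wilson measure -/

/-- Monotonicity and homogeneity of `Measure.bind` in the measure, in the form used below. [folklore] -/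
theorem bind_le_smul_bind {X : Type*} [MeasurableSpace X] {μ ν : Measure X} (κ : Kernel X X) {c : ℝ≥0∞}
    (h : μ ≤ c • ν) : μ.bind κ ≤ c • ν.bind κ := by
  rw [Measure.le_iff]
  intro s hs
  rw [Measure.bind_apply hs κ.aemeasurable, Measure.smul_apply, Measure.bind_apply hs κ.aemeasurable,
    ← lintegral_smul_measure]
  exact lintegral_mono' h le_rfl

/-- ★ **Uniform-in-time density bound**: for every coupling `β'`, start `z` and lattice time `t₁ > 0` there is `C` such that EVERY
solution from `z` on ANY space has `law(U_{t₁ + s}) ≤ C · Haar^{⊗E}` for ALL `s ≥ 0`.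
[cite: ShenZhuZhu2022, §3 Lemma 3.3 (p. 13)] [folklore] -/
theorem map_le_smul_haar_of_le (β' : ℝ) {t₁ : ℝ≥0} (ht₁ : 0 < (t₁ : ℝ))
    (z : GaugeConfig 3 L (Matrix.specialUnitaryGroup (Fin 2) ℂ)) :
    ∃ C : ℝ, 0 ≤ C ∧ ∀ {Ω : Type} [MeasurableSpace Ω] {P : Measure Ω} [IsProbabilityMeasure P]
      {W : ℝ≥0 → Ω → (Edge 3 L × NoiseIdx 2 → ℝ)} (hW : IsFlatBrownian W P)
      {U : ℝ≥0 → Ω → GaugeConfig 3 L (Matrix.specialUnitaryGroup (Fin 2) ℂ)}, (∀ ω, U 0 ω = z) →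
      (latticeLangevinDynamics (fundamentalLatticeRep 2) β').IsSolution (fundamentalRep (Fin 2)) hW.natFiltration P W U →
      ∀ s : ℝ≥0, P.map (U (t₁ + s)) ≤ (ENNReal.ofReal C) •
        (Measure.pi fun _ : Edge 3 L => haarProbability (Matrix.specialUnitaryGroup (Fin 2) ℂ)) := by
  classical
  haveI := secondCountableTopology_su2
  haveI := borelSpace_config L
  -- THE kernels; Wilson invariance in kernel form; Wilson/Haar comparison
  obtain ⟨κ, hκM, -, hreal⟩ := exists_transitionKernel L β'
  haveI := hκM
  have hinv : ∀ t, Kernel.Invariant (κ t) (wilsonMeasure (d := 3) (L := L) (fundamentalRep (Fin 2)) β') :=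
    (wilsonMeasureLangevinInvariant_iff_kernelInvariant (L := L) β' κ hreal).mp (wilsonMeasureLangevinInvariant_su2 L β')
  obtain ⟨a, ha, hWle, hπle⟩ := wilsonMeasure_le_smul_pi_haar_and (L := L) β'
  -- the regular flow on the product Wiener space realises every law; bound at time `t₁`
  haveI := isProbabilityMeasure_piWiener (Edge 3 L × NoiseIdx 2)
  have hWc := isFlatBrownian_piWiener 3 L (NoiseIdx 2)
  obtain ⟨X, -, hX, -, -, -, -⟩ := exists_regularFlow L β' hWc
  obtain ⟨C₁, hC₁, hle₁⟩ := map_le_smul_haar (L := L) β' ht₁ z hWc (fun ω => (hX z).1 ω) (hX z).2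
  refine ⟨C₁ * (a * a), by positivity, ?_⟩
  intro Ω mΩ P hP W hW U hU0 hU s
  -- law at `t₁ + s` through the kernels: `κ_{t₁+s}(z) = (κ_{t₁} z).bind κ_s`
  have hlaw : P.map (U (t₁ + s)) = (κ t₁ z).bind (κ s) := by
    rw [← hreal (t₁ + s) z Ω P W hW U hU0 hU, chapmanKolmogorov_szz β' κ hreal t₁ s, Kernel.comp_apply]
  have hκt₁ : κ t₁ z ≤ (ENNReal.ofReal C₁) •
      (Measure.pi fun _ : Edge 3 L => haarProbability (Matrix.specialUnitaryGroup (Fin 2) ℂ)) := by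
    rw [hreal t₁ z _ _ _ hWc (X z) (hX z).1 (hX z).2]
    exact hle₁
  rw [hlaw, ENNReal.ofReal_mul hC₁, ENNReal.ofReal_mul ha.le]
  -- `(κ t₁ z).bind κ_s ≤ C₁ • π.bind κ_s ≤ C₁ a • μ_W.bind κ_s = C₁ a • μ_W ≤ C₁ a² • π`
  have h1 := bind_le_smul_bind (κ s) hκt₁
  have h2 := bind_le_smul_bind (κ s) hπle
  have h3 : (wilsonMeasure (d := 3) (L := L) (fundamentalRep (Fin 2)) β').bind (κ s) =
      wilsonMeasure (d := 3) (L := L) (fundamentalRep (Fin 2)) β' := hinv s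
  rw [h3] at h2
  rw [Measure.le_iff]
  intro A hA
  have e1 := Measure.le_iff.1 h1 A hA
  have e2 := Measure.le_iff.1 h2 A hA
  have e3 := Measure.le_iff.1 hWle A hA
  simp only [Measure.smul_apply, smul_eq_mul] at e1 e2 e3 ⊢
  calc ((κ t₁ z).bind (κ s)) A
      ≤ ENNReal.ofReal C₁ * ((Measure.pi fun _ : Edge 3 L =>
          haarProbability (Matrix.specialUnitaryGroup (Fin 2) ℂ)).bind (κ s)) A := e1
    _ ≤ ENNReal.ofReal C₁ * (ENNReal.ofReal a * (wilsonMeasure (d := 3) (L := L) (fundamentalRep (Fin 2)) β') A) :=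
        mul_le_mul' le_rfl e2
    _ ≤ ENNReal.ofReal C₁ * (ENNReal.ofReal a * (ENNReal.ofReal a *
          (Measure.pi fun _ : Edge 3 L => haarProbability (Matrix.specialUnitaryGroup (Fin 2) ℂ)) A)) :=
        mul_le_mul' le_rfl (mul_le_mul' le_rfl e3)
    _ = ENNReal.ofReal C₁ * (ENNReal.ofReal a * ENNReal.ofReal a) *
          (Measure.pi fun _ : Edge 3 L => haarProbability (Matrix.specialUnitaryGroup (Fin 2) ℂ)) A := by ring

end Summit.QuantumFields.YangMills.Theorems.ColdStartUniversality

end
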